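import Mathlib
import Summits.QuantumFields.Balaban3D.Carriers.Tower
import Summits.QuantumFields.Balaban3D.Proofs.TorusLift
import Summits.QuantumFields.Balaban3D.Proofs.AdmissibleRegions
import Summits.QuantumFields.Balaban3D.Proofs.Run3Collar
import Summits.QuantumFields.Balaban3D.Proofs.PerPlaquette71
import Summits.QuantumFields.Balaban3D.Proofs.LargeFieldKnit
import Summits.QuantumFields.Balaban3D.Proofs.Run3LargeField

/-!
# `Summit.QuantumFields.Balaban3D.Proofs.Run3SmallFactors` — lane «pub-balaban3d» (Bałaban, CMP **102** (1985) 255–275, d = 3 lattice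
# UV stability AS PRINTED), prover seat p2: the small-factors leaf (67)–(71) FOR THE LANE'S TOWER on ADMISSIBLE histories — the
# hypothesis `hSF` of `…Proofs.Run3LargeField.lf_tower3_adm`

HONEST FRAMING (lane PLAN.md §0).  Nothing of [B10] = [Balaban1985UV3] is asserted.  p. 273 L11–L22: every large-field plaquette
`p′ ∈ P_j` of an (admissible) history yields the small factor `exp(−¼ g_k⁻² p(g_j)² ·…)` out of the main action, by (67) `Ū^j = V_j`,
the regularity (68) of `U_k` on `B^j(Λ_j)`, and (69)–(71).  Here: the per-plaquette inequality (71) on `ηℤ³` is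
`…Proofs.PerPlaquette71.perPlaquette71_local` (the 4D cell's `B10Eq69Local`); this file supplies the lane-specific double counting:
* (`…Proofs.AdmissibleRegions`:) regions of different scales do not pile up on admissible histories, and a fine plaquette lies in the
  cover of at most four scale-`j` plaquettes of a given orientation ⇒ multiplicity `≤ 4` (`card_filter_regionT_le_four`);
* `smallFactorsAdm_tower3`: the hypothesis `hSF` of `lf_tower3_adm` with `c₁ = 1/(4N)`, from the (α) DATA DISPLAYS (67), (68) and
  the large-field condition about the tower's minimizers `U_k(h, ·)` read through a `U(N)`-valued `ηℤ³` configuration `Ul k h U`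
  (the lift — DATA here) and ONE carrier-interface identity `hbridge` (plaquette terms of the torus action of `U_k(h,U)` = those of
  the lift; seat p1's lift lemma), lead rulings R-DISP / LEAF-LEDGER §F3 (68), §F4.
-/

noncomputable section

namespace Summit.QuantumFields.Balaban3D.Proofs.Run3SmallFactors

open Literature.MathematicalPhysics.QuantumFieldTheory.Balaban1983to89
open Literature.MathematicalPhysics.QuantumFieldTheory.Balaban1985CMP102
open Literature.MathematicalPhysics.QuantumFieldTheory.Balaban1985CMP102.Setting
open Summit.QuantumFields.Balaban3D.Carriers
open Summit.QuantumFields.Balaban3D.Proofs.TorusLift (projSite zOf projSite_mem_plaqCover projSite_injOn_deltaBox)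
open Summit.QuantumFields.Balaban3D.Proofs.AdmissibleRegions (scale_eq_of_mem_plaqCover card_sources_le_four)
open B10Eq70Squaring (deltaBox)
open Finset

/-! ## §1 The regions `Δ′(e)` on the torus and the small-factors leaf on admissible histories -/

section Tower

open scoped Matrix.Norms.L2Operator
open B7Prop1Explicit (hol plaqWord)
open B7Prop1Local (pdevOn loK plaqHiK)
open B7Prop2Explicit (avgIter unitaryUnits)
open Summit.QuantumFields.Balaban3D.Proofs.PerPlaquette71 (perPlaquette71_local_gamma)
open Summit.QuantumFields.Balaban3D.Proofs.Thresholds (gamma71L)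
open Summit.QuantumFields.Balaban3D.Proofs.LargeFieldKnit (sum_sum_mem_le_mul_sum)

variable {L : ℕ} {S : Scales L} {G : Type} [GaugeGroup G] [MeasurableSpace G] [HaarData G]

/-- The integer position (scale-`j` labels as integers) of a scale-tagged plaquette code. [folklore] -/
def codeZ (e : ℕ × PlaqCode S.P) : B7Prop1Explicit.Site S.P.d := fun κ => ((e.2.1 κ : ℕ) : ℤ)

/-- The torus region `Δ′(e)` of (69)–(70) of a code `e = (j, p′)`: the unit plaquettes of the torus, of the orientation of `p′`, whose
base points are the projections of the integer box `deltaBox (L^j) (L^j • codeZ e)` (the four `j`-blocks at the corners of `p′`).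
[cite: Balaban1985UV3, (69)–(70) p.273] -/
def regionT (e : ℕ × PlaqCode S.P) : Finset (Plaq S.P 0) :=
  if hμν : e.2.2.1 < e.2.2.2 then
    (deltaBox (L ^ e.1) ((L ^ e.1 : ℕ) • codeZ e) e.2.2.1 e.2.2.2).image
      (fun y => (⟨projSite y, e.2.2.1, e.2.2.2, hμν⟩ : Plaq S.P 0))
  else ∅

/-- Decoding a code of a history: `e ∈ disc h` is `(j, plaqCode p′)` with `p′ ∈ P_j(h)`, and then `codeZ e = zOf p′`. [folklore] -/
theorem decode_of_mem_disc {k : ℕ} {h : Hist S.P k} {e : ℕ × PlaqCode S.P} (he : e ∈ Hist.disc h) :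
    ∃ (j : ℕ) (hj : j < k) (p : Plaq S.P j), p ∈ h ⟨j, hj⟩ ∧ e = (j, plaqCode p) ∧ codeZ e = zOf p ∧
      e.2.2.1 = p.μ ∧ e.2.2.2 = p.ν := by
  rw [Hist.mem_disc] at he
  obtain ⟨i, p, hp, rfl⟩ := he
  exact ⟨i, i.2, p, hp, rfl, rfl, rfl, rfl⟩

/-- A unit plaquette of `Δ′(j, p′)` has its base point covered by `p′` and the orientation of `p′`. [cite: Balaban1985UV3, (69) p.273] -/
theorem src_mem_plaqCover_of_mem_regionT {j : ℕ} (hj : j ≤ S.P.m + S.P.K) (p' : Plaq S.P j) {q : Plaq S.P 0}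
    (hq : q ∈ regionT (S := S) (j, plaqCode p')) : q.src ∈ plaqCover p' ∧ q.μ = p'.μ ∧ q.ν = p'.ν := by
  unfold regionT at hq
  simp only [plaqCode] at hq
  rw [dif_pos p'.hμν, Finset.mem_image] at hq
  obtain ⟨y, hy, rfl⟩ := hq
  exact ⟨projSite_mem_plaqCover hj p' hy, rfl, rfl⟩

/-- **Multiplicity ≤ 4 of the regions `Δ′(e)`, `e ∈ P(h)`, on an ADMISSIBLE history** (print: the regions are disjoint; the 4D cell's
GAPS G-B10-10(a)): a unit plaquette lies in the regions of codes of ONE scale only (`scale_eq_of_mem_plaqCover`) and, at that scale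
and its own orientation, of at most four plaquettes (`card_sources_le_four`). [cite: Balaban1985UV3, (69)–(71) p.273] -/
theorem card_filter_regionT_le_four (D : TowerInput S G) {k : ℕ} (hk : k ≤ S.P.m + S.P.K) {h : Hist S.P k}
    (hh : Hist.Admissible D.M₁ D.Rcol k h) (q : Plaq S.P 0) :
    ((Hist.disc h).filter (fun e => q ∈ regionT (S := S) e)).card ≤ 4 := by
  classical
  set F := (Hist.disc h).filter (fun e => q ∈ regionT (S := S) e) with hF
  rcases F.eq_empty_or_nonempty with hE | ⟨e₀, he₀⟩
  · rw [hE, Finset.card_empty]; norm_num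
  obtain ⟨he₀d, hq₀⟩ := Finset.mem_filter.mp he₀
  obtain ⟨j₀, hj₀, p₀, hp₀, rfl, -, -, -⟩ := decode_of_mem_disc he₀d
  obtain ⟨hcov₀, -, -⟩ := src_mem_plaqCover_of_mem_regionT (by omega) p₀ hq₀
  -- every source has scale j₀ and covers q.src with q's orientation
  let T : Finset (Plaq S.P j₀) := (h ⟨j₀, hj₀⟩).filter (fun p' => p'.μ = q.μ ∧ p'.ν = q.ν ∧ q.src ∈ plaqCover p')
  have hsub : F ⊆ T.image (fun p' => ((j₀ : ℕ), plaqCode p')) := by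
    intro e he
    obtain ⟨hed, hqe⟩ := Finset.mem_filter.mp he
    obtain ⟨j, hj, p', hp', rfl, -, -, -⟩ := decode_of_mem_disc hed
    obtain ⟨hcov, hμ, hν⟩ := src_mem_plaqCover_of_mem_regionT (by omega) p' hqe
    have hjj : j = j₀ := scale_eq_of_mem_plaqCover D.M₁ D.Rcol hh hj hj₀ hp' hp₀ hcov hcov₀
    subst hjj
    exact Finset.mem_image.mpr ⟨p', Finset.mem_filter.mpr ⟨hp', hμ.symm, hν.symm, hcov⟩, rfl⟩
  calc F.card ≤ (T.image (fun p' => ((j₀ : ℕ), plaqCode p'))).card := Finset.card_le_card hsub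
    _ ≤ T.card := Finset.card_image_le
    _ ≤ 4 := card_sources_le_four q.src q.μ q.ν q.hμν T (fun p' hp' => (Finset.mem_filter.mp hp').2)

/-- **THE SMALL-FACTORS LEAF (67)–(71) FOR THE LANE'S TOWER ON ADMISSIBLE HISTORIES** — the hypothesis `hSF` of
`…Run3LargeField.lf_tower3_adm` with `c₁ = 1/(4N)` (p. 273 L11–L22).  FROM: the (α) data displays about the tower's minimizers
`U_k(h,·)` read through a `U(N)`-valued `ηℤ³` configuration `Ul k h U` (the lift; `SU(N) ⊂ U(N)`) and configurations `Vl k h U j` (the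
fields `V_j`): **(67)** `Ū^j(∂p′) = V_j(∂p′)`, the large-field condition `|V_j(∂p′) − 1| ≥ g_jp(g_j)` and **(68)** on `Δ′(p′)` for every
recorded `(j, p′) ∈ P(h)`; the carrier-interface identity `hbridge` (the plaquette terms of the torus action `η_k⁻¹[1 − Re tr U_k(∂p)]`
are those of the lift, `L^k[1 − N⁻¹ Re Tr Ul(∂y)]`, at `p = proj y`); the coupling window `g_j ≤ γ₇₁ᴸ` (`Thresholds.gamma71L`) on
the flow.  Per plaquette: `…PerPlaquette71.perPlaquette71_local_gamma` (4D cell `B10Eq69Local`); globally: multiplicity `≤ 4`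
(`card_filter_regionT_le_four`) and double counting. [cite: Balaban1985UV3, (67)–(71) p.273] -/
theorem smallFactorsAdm_tower3 (D : TowerInput S G) {N : ℕ} [NeZero N] (hL : 2 ≤ L) {gb ε C₁ gs : ℝ} (hgb : 0 < gb)
    (hε : 0 < ε) (hC₁ : 0 < C₁) (hb₀ : 0 < D.b₀) (hp₀ : 0 < D.p₀)
    (hrun : ∀ i, S.gk i = B10.gRun gb L ε i)
    (hγ : ∀ j, j < S.K → S.gk j ≤ gamma71L C₁ L D.b₀ D.p₀)
    (Ul : (k : ℕ) → Hist S.P k → GaugeField S.P k G → B7Prop1Explicit.Site S.P.d → Fin S.P.d → (Matrix (Fin N) (Fin N) ℂ)ˣ)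
    (Vl : (k : ℕ) → Hist S.P k → GaugeField S.P k G → ℕ →
      B7Prop1Explicit.Site S.P.d → Fin S.P.d → (Matrix (Fin N) (Fin N) ℂ)ˣ)
    (hU : ∀ k h U x κ, Ul k h U x κ ∈ unitaryUnits (Matrix (Fin N) (Fin N) ℂ))
    (hbridge : ∀ (k : ℕ) (h : Hist S.P k) (U : GaugeField S.P k G) (y : B7Prop1Explicit.Site S.P.d) (μ ν : Fin S.P.d)
      (hμν : μ < ν), (S.eta k)⁻¹ * (1 - reTr (GaugeField.plaqHol (D.UkH k h U) ⟨projSite y, μ, ν, hμν⟩)) =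
        (L : ℝ) ^ k * (1 - (N : ℝ)⁻¹ *
          (((hol (Ul k h U) y (plaqWord μ ν) : (Matrix (Fin N) (Fin N) ℂ)ˣ) : Matrix (Fin N) (Fin N) ℂ).trace.re)))
    (h67 : ∀ k, k ≤ S.K → ∀ (h : Hist S.P k), Hist.Admissible D.M₁ D.Rcol k h → ∀ (U : GaugeField S.P k G),
      ∀ e ∈ Hist.disc h, hol (avgIter L (Ul k h U) e.1) (codeZ e) (plaqWord e.2.2.1 e.2.2.2) =
        hol (Vl k h U e.1) (codeZ e) (plaqWord e.2.2.1 e.2.2.2))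
    (hLF : ∀ k, k ≤ S.K → ∀ (h : Hist S.P k), Hist.Admissible D.M₁ D.Rcol k h → ∀ (U : GaugeField S.P k G),
      ∀ e ∈ Hist.disc h, S.gk e.1 * B10.pFun D.b₀ D.p₀ (S.gk e.1) ≤
        ‖((hol (Vl k h U e.1) (codeZ e) (plaqWord e.2.2.1 e.2.2.2) : (Matrix (Fin N) (Fin N) ℂ)ˣ) :
          Matrix (Fin N) (Fin N) ℂ) - 1‖)
    (h68 : ∀ k, k ≤ S.K → ∀ (h : Hist S.P k), Hist.Admissible D.M₁ D.Rcol k h → ∀ (U : GaugeField S.P k G),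
      ∀ e ∈ Hist.disc h, pdevOn (loK L e.1 (codeZ e)) (plaqHiK L e.1 (codeZ e) e.2.2.1 e.2.2.2) (Ul k h U) <
        C₁ * (S.gk e.1 * B10.pFun D.b₀ D.p₀ (S.gk e.1)) * (((L : ℝ) ^ e.1)⁻¹) ^ 2) :
    (∀ j, j ≤ S.K → 0 < S.gk j ∧ S.gk j ≤ gs) → ∀ k, k ≤ S.K → ∀ (U : GaugeField S.P k G) (h : Hist S.P k),
      Hist.Admissible D.M₁ D.Rcol k h →
        1 / (4 * (N : ℝ)) * ∑ e ∈ Hist.disc h, B10.pFun D.b₀ D.p₀ (S.gk e.1) ^ 2 / 4 ≤ D.tower3.mainT k h U := by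
  intro _ k hk U h hh
  classical
  have hkP : k ≤ S.P.m + S.P.K := by show k ≤ S.m + S.K; omega
  have hN : (0 : ℝ) < N := by exact_mod_cast Nat.pos_of_ne_zero (NeZero.ne N)
  -- the plaquette terms of the torus action
  set act : Plaq S.P 0 → ℝ := fun q => (S.eta k)⁻¹ * (1 - reTr (GaugeField.plaqHol (D.UkH k h U) q)) with hact
  have heta : 0 < S.eta k := by
    show 0 < ((S.P.L : ℝ)⁻¹) ^ k
    exact pow_pos (inv_pos.mpr (by exact_mod_cast S.P.L_pos)) k
  have hact0 : ∀ q, 0 ≤ act q := fun q =>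
    mul_nonneg (inv_nonneg.mpr heta.le) (sub_nonneg.mpr (GaugeGroup.reTr_le_one _))
  have hmain : (S.gk k)⁻¹ ^ 2 * ∑ q, act q = D.tower3.mainT k h U := rfl
  -- (71) per recorded plaquette, transported to the torus
  have h71 : ∀ e ∈ Hist.disc h, B10.pFun D.b₀ D.p₀ (S.gk e.1) ^ 2 / 4 ≤
      (N : ℝ) * ((S.gk k)⁻¹ ^ 2 * ∑ q ∈ regionT (S := S) e, act q) := by
    intro e he
    obtain ⟨j, hj, p', hp', hej, hz, hμ, hν⟩ := decode_of_mem_disc he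
    have he1 : e.1 = j := by rw [hej]
    have hμν : e.2.2.1 < e.2.2.2 := by rw [hμ, hν]; exact p'.hμν
    have key := perPlaquette71_local_gamma L hL hgb hε hb₀ hp₀ hC₁ S.gk hrun (j := e.1) (k := k) (by omega)
      (hγ e.1 (by omega)) (Ul k h U) (Vl k h U e.1) (hU k h U) (codeZ e) (ne_of_lt hμν) (h67 k hk h hh U e he)
      (hLF k hk h hh U e he) (h68 k hk h hh U e he)
    refine key.trans (le_of_eq ?_)
    congr 1
    congr 1
    -- the box sum = the sum over the torus region
    have hinj : Set.InjOn (fun y => (⟨projSite y, e.2.2.1, e.2.2.2, hμν⟩ : Plaq S.P 0))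
        (deltaBox (L ^ e.1) ((L ^ e.1 : ℕ) • codeZ e) e.2.2.1 e.2.2.2 : Set (B7Prop1Explicit.Site S.P.d)) := by
      intro y hy y' hy' hyy
      have h2 : 2 * L ^ e.1 ≤ S.P.sitesPerDir 0 := by
        show 2 * L ^ e.1 ≤ 2 * L ^ (S.m + S.K - 0)
        rw [Nat.sub_zero]
        exact Nat.mul_le_mul_left 2 (Nat.pow_le_pow_right (by omega) (by omega))
      exact projSite_injOn_deltaBox h2 _ _ _ hy hy' (congrArg Plaq.src hyy)
    unfold regionT
    rw [dif_pos hμν, Finset.sum_image hinj]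
    refine Finset.sum_congr rfl fun y _ => ?_
    rw [hact]
    exact (hbridge k h U y e.2.2.1 e.2.2.2 hμν).symm
  -- double counting with multiplicity 4
  have hsum : ∑ e ∈ Hist.disc h, B10.pFun D.b₀ D.p₀ (S.gk e.1) ^ 2 / 4 ≤
      (N : ℝ) * ((S.gk k)⁻¹ ^ 2 * ∑ e ∈ Hist.disc h, ∑ q ∈ regionT (S := S) e, act q) := by
    calc ∑ e ∈ Hist.disc h, B10.pFun D.b₀ D.p₀ (S.gk e.1) ^ 2 / 4
        ≤ ∑ e ∈ Hist.disc h, (N : ℝ) * ((S.gk k)⁻¹ ^ 2 * ∑ q ∈ regionT (S := S) e, act q) := Finset.sum_le_sum h71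
      _ = (N : ℝ) * ((S.gk k)⁻¹ ^ 2 * ∑ e ∈ Hist.disc h, ∑ q ∈ regionT (S := S) e, act q) := by
          rw [Finset.mul_sum, Finset.mul_sum]
  have hdc : ∑ e ∈ Hist.disc h, ∑ q ∈ regionT (S := S) e, act q ≤ (4 : ℕ) * ∑ q, act q :=
    sum_sum_mem_le_mul_sum (Hist.disc h) Finset.univ (regionT (S := S)) act (fun q _ => hact0 q)
      (fun _ _ => Finset.subset_univ _) 4 (fun q _ => card_filter_regionT_le_four D hkP hh q)
  have hg0 : 0 ≤ (S.gk k)⁻¹ ^ 2 := sq_nonneg _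
  calc 1 / (4 * (N : ℝ)) * ∑ e ∈ Hist.disc h, B10.pFun D.b₀ D.p₀ (S.gk e.1) ^ 2 / 4
      ≤ 1 / (4 * (N : ℝ)) * ((N : ℝ) * ((S.gk k)⁻¹ ^ 2 * ((4 : ℕ) * ∑ q, act q))) := by
        refine mul_le_mul_of_nonneg_left (hsum.trans ?_) (by positivity)
        exact mul_le_mul_of_nonneg_left (mul_le_mul_of_nonneg_left hdc hg0) hN.le
    _ = (S.gk k)⁻¹ ^ 2 * ∑ q, act q := by
        push_cast
        field_simp
    _ = D.tower3.mainT k h U := hmain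

end Tower

/-! ## §2 The leaf `LeafSystem.lf` for the tower from the (α) displays -/

section Final

open scoped Matrix.Norms.L2Operator
open B7Prop1Explicit (hol plaqWord)
open B7Prop1Local (pdevOn loK plaqHiK)
open B7Prop2Explicit (avgIter unitaryUnits)
open B10LargeField (xlog)
open Summit.QuantumFields.Balaban3D.Proofs.Thresholds (gamma71L)
open Summit.QuantumFields.Balaban3D.Proofs.Run3LargeField (lf_tower3_adm)

variable {L : ℕ} {S : Scales L} {G : Type} [GaugeGroup G] [MeasurableSpace G] [HaarData G]

/-- **`B10Assembly.LeafSystem.lf` FOR THE LANE'S TOWER FROM THE PRINTED DISPLAYS** — the large-field leaf of Theorem 1's knit at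
`D.tower3`, literally the field type, with EVERY p2-side intermediate discharged: the collar count (`Run3LargeField.collar_tower3`), the
small factors (67)–(71) (`smallFactorsAdm_tower3`), the resummation of pp. 273–274 (`LargeFieldKnitAdm`).  What remains as
hypotheses is exactly: the (α) DATA DISPLAYS (67), large-field condition, (68) about the minimizers read through the lift `Ul`/`Vl`
(lead ruling R-DISP, LEAF-LEDGER §F3), the carrier-interface identity `hbridge` (§F4; p1's lift lemma), the vanishing of the masses
off admissible histories `hW` (p1's `Carriers.Masses`), the booked Z-term rates `hz0`/`hz` and collar-width data `hM`/`hRcol`/`hRle`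
on the window `≤ K` (p3's constants), the coupling window (`hrun`, `hγ`, `hg`, `hgs`), `hsites`, `C.d = 6/log L`, and the provisos NOT IN PRINT
(`hp`, `hb₁`, `hb₂` with `c₁ = 1/(4N)`, `c_gρ = K_c`; 4D cell GAPS G-B10-02/G-B10-10). [cite: Balaban1985UV3, pp.273–274, (67)–(71) p.273] -/
theorem lf_tower3_final (C : B10Assembly.Consts) (hd : C.d = 6 / Real.log C.L) (hCL : C.L = (L : ℝ)) (hL : 2 ≤ L)
    (D : TowerInput S G) {N : ℕ} [NeZero N] {ρ' r₀ A gs ε C₁ : ℝ}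
    (hsites : ∀ k, k ≤ S.K → S.sites k = (Fintype.card (Site S.P k) : ℝ))
    (hW : ∀ (k : ℕ) (h : Hist S.P k) (U : GaugeField S.P k G), ¬ Hist.Admissible D.M₁ D.Rcol k h → D.W.mass k h U = 0)
    -- the (α) displays (67), large field, (68) through the lift, and the bridge
    (hε : 0 < ε) (hC₁ : 0 < C₁) (hb₀ : 0 < D.b₀) (hp₀ : 0 < D.p₀)
    (hrun : ∀ j, S.gk j = B10.gRun C.g C.L ε j)
    (hγ : ∀ j, j < S.K → S.gk j ≤ gamma71L C₁ L D.b₀ D.p₀)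
    (Ul : (k : ℕ) → Hist S.P k → GaugeField S.P k G → B7Prop1Explicit.Site S.P.d → Fin S.P.d → (Matrix (Fin N) (Fin N) ℂ)ˣ)
    (Vl : (k : ℕ) → Hist S.P k → GaugeField S.P k G → ℕ →
      B7Prop1Explicit.Site S.P.d → Fin S.P.d → (Matrix (Fin N) (Fin N) ℂ)ˣ)
    (hU : ∀ k h U x κ, Ul k h U x κ ∈ unitaryUnits (Matrix (Fin N) (Fin N) ℂ))
    (hbridge : ∀ (k : ℕ) (h : Hist S.P k) (U : GaugeField S.P k G) (y : B7Prop1Explicit.Site S.P.d) (μ ν : Fin S.P.d)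
      (hμν : μ < ν), (S.eta k)⁻¹ * (1 - reTr (GaugeField.plaqHol (D.UkH k h U) ⟨projSite y, μ, ν, hμν⟩)) =
        (L : ℝ) ^ k * (1 - (N : ℝ)⁻¹ *
          (((hol (Ul k h U) y (plaqWord μ ν) : (Matrix (Fin N) (Fin N) ℂ)ˣ) : Matrix (Fin N) (Fin N) ℂ).trace.re)))
    (h67 : ∀ k, k ≤ S.K → ∀ (h : Hist S.P k), Hist.Admissible D.M₁ D.Rcol k h → ∀ (U : GaugeField S.P k G),
      ∀ e ∈ Hist.disc h, hol (avgIter L (Ul k h U) e.1) (codeZ e) (plaqWord e.2.2.1 e.2.2.2) =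
        hol (Vl k h U e.1) (codeZ e) (plaqWord e.2.2.1 e.2.2.2))
    (hLF : ∀ k, k ≤ S.K → ∀ (h : Hist S.P k), Hist.Admissible D.M₁ D.Rcol k h → ∀ (U : GaugeField S.P k G),
      ∀ e ∈ Hist.disc h, S.gk e.1 * B10.pFun D.b₀ D.p₀ (S.gk e.1) ≤
        ‖((hol (Vl k h U e.1) (codeZ e) (plaqWord e.2.2.1 e.2.2.2) : (Matrix (Fin N) (Fin N) ℂ)ˣ) :
          Matrix (Fin N) (Fin N) ℂ) - 1‖)
    (h68 : ∀ k, k ≤ S.K → ∀ (h : Hist S.P k), Hist.Admissible D.M₁ D.Rcol k h → ∀ (U : GaugeField S.P k G),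
      ∀ e ∈ Hist.disc h, pdevOn (loK L e.1 (codeZ e)) (plaqHiK L e.1 (codeZ e) e.2.2.1 e.2.2.2) (Ul k h U) <
        C₁ * (S.gk e.1 * B10.pFun D.b₀ D.p₀ (S.gk e.1)) * (((L : ℝ) ^ e.1)⁻¹) ^ 2)
    -- collar widths, Z-term rates, couplings
    (hM : 0 < D.M₁) (hRcol : ∀ i j, i ≤ j → j ≤ S.K → D.Rcol j ≤ D.Rcol i) (hρ : 0 ≤ ρ') (hr : 0 ≤ r₀)
    (hRle : ∀ i, i ≤ S.K → (D.Rcol i : ℝ) ≤ ρ' * xlog (S.gk i) ^ r₀)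
    (hz0 : ∀ j, j < S.K → 0 ≤ D.zcoef j) (hz : ∀ j, j < S.K → D.zcoef j ≤ A * xlog (S.gk j))
    (hA : 0 ≤ A)
    (hg : ∀ j, j ≤ S.K → 0 < S.gk j ∧ S.gk j ≤ gs) (hgs : gs ≤ 1)
    -- provisos NOT IN PRINT
    (hp : r₀ * 3 + 2 ≤ 2 * D.p₀)
    (hb₁ : 8 * (A * (2 * (2 * ρ' + 2 * ((L : ℝ) * (3 * ((D.M₁ : ℝ) - 1)) + 3 * ((L : ℝ) - 1)) + 20) * 1) ^ 3 /
      (Real.log C.L / 2)) ≤ 1 / (4 * (N : ℝ)) * D.b₀ ^ 2)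
    (hb₂ : 56 ≤ 1 / (4 * (N : ℝ)) * D.b₀ ^ 2) :
    ∀ k, k ≤ D.tower3.toTowerRun.K → ∀ U : D.tower3.toTowerRun.Cfg k,
      D.tower3.toTowerRun.LF k U (fun h => -(D.tower3.toTowerRun.mainT k h U) + D.tower3.toTowerRun.Zterm k h) ≤
        Real.exp (C.d * D.tower3.toTowerRun.sites k) := by
  have hrun' : ∀ i, S.gk i = B10.gRun C.g L ε i := fun i => by rw [hrun i, hCL]
  exact lf_tower3_adm C hd hCL hL D hsites hW
    (smallFactorsAdm_tower3 D hL C.g_pos hε hC₁ hb₀ hp₀ hrun' hγ Ul Vl hU hbridge h67 hLF h68)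
    hM hRcol hρ hr hRle hz0 hz hA hε hrun hg hgs hp hb₁ hb₂

end Final

end Summit.QuantumFields.Balaban3D.Proofs.Run3SmallFactors

end
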